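import Summits.HubbardSuperconductivity.HubbardSuperconductivity.Theorems.AnisotropyChordTransferFibre3KT2bRow
import Summits.HubbardSuperconductivity.HubbardSuperconductivity.Theorems.AnisotropyChordTransferFibre3Lam2Bounds

/-!
# Route `AnisotropyChord` / H0 rotor rung: PartN41-C §1 and §2 (first part) PROVED — the drops, `R̄` closed, the `Q₀` expansion

Theory-1 g22's PartN41-C (port …Fibre3KT2bRow), KT-2b row of the Level-2 certificate of piece A:
* §1 drops ★ `polePartNonneg_holds : PolePartNonneg L Δ`, ★ `lowNormPartNonneg_holds : LowNormPartNonneg L Δ` (sums of `normSq/V²`);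
* §2 ★ `rbarClosed_holds : RbarClosed L Δ` — `R̄ = τ̄ − 2η_eff²` (`∇ₓs(0) = η_eff`, `∇ₓs(x̂) = −η_eff` by the sum rule
  `η_eff = (1−Δ)f_nn`, `etaEff_eq`);
* §2 ★ `q0Expansion_holds : Q0Expansion L Δ` — `Σ_{r≠0} s = −1` and `Q₀ = V + 3 + 6Σ′s² − 4Σ′s³ + Σ′s⁴` (`f = 1 − s` off the
  origin, `f(0) = 0`, `Σ f = V`).
Prover seat `hubbard-h0-rotor-p1` g27 (route lead; row C §1–§2 taken over from the FIN-saturated p3 lineage); helper for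
stmt-HubbardSuperconductivity-23918 (`--supports`, helper class).
WHAT THIS IS NOT: nothing here proves superconductivity in the Hubbard model; closed forms of inputs of ONE row of ONE conditional
reduction.  Tree imports only; no new definitions; no sorry, no axioms.
-/

set_option linter.dupNamespace false
set_option autoImplicit false

noncomputable section

open scoped BigOperators

namespace Summit.HubbardSuperconductivity.HubbardSuperconductivity.Theorems.AnisotropyChord.Transfer.Fibre3

variable (L : ℕ) [NeZero L]

/-! ## §1 The drops -/

/-- ★ `P ≥ 0`. [folklore] -/
theorem polePartNonneg_holds (Δ : ℝ) : PolePartNonneg L Δ := by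
  intro f
  unfold polePart
  exact Finset.sum_nonneg fun j _ => div_nonneg (Complex.normSq_nonneg _) (by positivity)

/-- ★ `lowN ≥ 0`. [folklore] -/
theorem lowNormPartNonneg_holds (Δ : ℝ) : LowNormPartNonneg L Δ := by
  intro f
  unfold lowNormPart
  exact Finset.sum_nonneg fun k _ => div_nonneg (Complex.normSq_nonneg _) (by positivity)

/-! ## §2 `R̄` closed -/

namespace RowC

/-- `∇ₓs(0) = η_eff` (`L ≥ 3`). [folklore] -/
theorem gradx_s_zero (hL : 3 ≤ L) {Δ lam2 : ℝ} {f : Tor L → ℝ} (hf : IsTwoMagnon L Δ lam2 f) :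
    gradx L (sfun L Δ f) 0 = etaEff L lam2 := by
  have hK := K1_ne_zero L (by omega)
  have hnn : f (-K1 L) = f (K1 L) := by
    have e : -K1 L = (((-1 : ZMod L)), (0 : ZMod L)) := by unfold K1; ext <;> simp
    rw [e]
    exact hf.2.1 _ (by unfold nnList; simp)
  unfold gradx sfun
  rw [if_pos rfl, zero_sub, if_neg (neg_ne_zero.mpr hK), hnn, etaEff_eq L hL hf]
  ring

/-- `∇ₓs(x̂) = −η_eff` (`L ≥ 3`). [folklore] -/
theorem gradx_s_K1 (hL : 3 ≤ L) {Δ lam2 : ℝ} {f : Tor L → ℝ} (hf : IsTwoMagnon L Δ lam2 f) :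
    gradx L (sfun L Δ f) (K1 L) = -etaEff L lam2 := by
  have hK := K1_ne_zero L (by omega)
  unfold gradx sfun
  rw [if_neg hK, sub_self, if_pos rfl, etaEff_eq L hL hf]
  ring

omit [NeZero L] in
/-- `R(a) = (∇ₓs(a))² − [a = 0](∇ₓs(a))² − [a = x̂](∇ₓs(a))²` (`L ≥ 2`). [folklore] -/
theorem Rwt_eq (hL : 2 ≤ L) (Δ : ℝ) (f : Tor L → ℝ) (a : Tor L) :
    Rwt L Δ f a = gradx L (sfun L Δ f) a ^ 2 - (if a = 0 then gradx L (sfun L Δ f) a ^ 2 else 0)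
      - (if a = K1 L then gradx L (sfun L Δ f) a ^ 2 else 0) := by
  have hK := K1_ne_zero L hL
  unfold Rwt
  by_cases h0 : a = 0
  · have h1 : a ≠ K1 L := by rw [h0]; exact fun h => hK h.symm
    simp [h0, hK.symm]
  · by_cases h1 : a = K1 L
    · simp [h1, hK]
    · simp [h0, h1]

/-- ★ `R̄ = τ̄ − 2η_eff²` (body of `RbarClosed L Δ`). [folklore] -/
theorem rbar_closed (hL : 3 ≤ L) {Δ lam2 : ℝ} {f : Tor L → ℝ} (hf : IsTwoMagnon L Δ lam2 f) :
    Rbar L Δ f = gradNormSq L Δ f - 2 * etaEff L lam2 ^ 2 := by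
  unfold Rbar gradNormSq
  rw [Finset.sum_congr rfl fun a _ => Rwt_eq L (by omega) Δ f a, Finset.sum_sub_distrib, Finset.sum_sub_distrib,
    Finset.sum_ite_eq' Finset.univ (0 : Tor L), Finset.sum_ite_eq' Finset.univ (K1 L)]
  simp only [Finset.mem_univ, if_true]
  rw [gradx_s_zero L hL hf, gradx_s_K1 L hL hf]
  ring

end RowC

/-- ★ **`RbarClosed L Δ` holds.** [folklore] -/
theorem rbarClosed_holds (Δ : ℝ) : RbarClosed L Δ :=
  fun _ _ hL hf => RowC.rbar_closed L hL hf.1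

/-! ## §2 The `Q₀` expansion -/

namespace RowC

/-- `#Tor L = V` as a real number. [folklore] -/
theorem card_tor : ((Finset.univ : Finset (Tor L)).card : ℝ) = (L : ℝ) ^ 2 := by
  rw [Finset.card_univ, Fintype.card_prod, ZMod.card]
  push_cast
  ring

/-- `Σ_{r ≠ 0} s(r) = −1` for a two-magnon profile (`Σ f = V`, `f(0) = 0`). [folklore] -/
theorem sum_s_erase {Δ lam2 : ℝ} {f : Tor L → ℝ} (hf : IsTwoMagnon L Δ lam2 f) :
    ∑ r ∈ (Finset.univ : Finset (Tor L)).erase 0, sfun L Δ f r = -1 := by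
  classical
  have h0 : f 0 = 0 := hf.1
  have hsum : ∑ r : Tor L, f r = (L : ℝ) ^ 2 := hf.2.2.2.1
  have e : ∀ r ∈ (Finset.univ : Finset (Tor L)).erase 0, sfun L Δ f r = 1 - f r := by
    intro r hr
    unfold sfun
    rw [if_neg (Finset.ne_of_mem_erase hr)]
  rw [Finset.sum_congr rfl e, Finset.sum_sub_distrib, Finset.sum_const, nsmul_eq_mul, mul_one,
    Finset.sum_erase (Finset.univ : Finset (Tor L)) (f := f) h0, hsum]
  have hc : (((Finset.univ : Finset (Tor L)).erase 0).card : ℝ) = (L : ℝ) ^ 2 - 1 := by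
    rw [Finset.card_erase_of_mem (Finset.mem_univ _)]
    have h1 : 1 ≤ (Finset.univ : Finset (Tor L)).card := Finset.card_pos.mpr ⟨0, Finset.mem_univ _⟩
    push_cast [Nat.cast_sub h1]
    rw [card_tor]
  rw [hc]
  ring

/-- ★ the `Q₀` expansion (body of `Q0Expansion L Δ`). [folklore] -/
theorem q0_expansion {Δ lam2 : ℝ} {f : Tor L → ℝ} (hf : IsTwoMagnon L Δ lam2 f) :
    (∑ r ∈ (Finset.univ : Finset (Tor L)).erase 0, sfun L Δ f r) = -1 ∧
    Q0 L f = (L : ℝ) ^ 2 + 3 + 6 * (∑ r ∈ (Finset.univ : Finset (Tor L)).erase 0, sfun L Δ f r ^ 2)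
      - 4 * (∑ r ∈ (Finset.univ : Finset (Tor L)).erase 0, sfun L Δ f r ^ 3)
      + (∑ r ∈ (Finset.univ : Finset (Tor L)).erase 0, sfun L Δ f r ^ 4) := by
  classical
  have hs := sum_s_erase L hf
  refine ⟨hs, ?_⟩
  have h0 : f 0 = 0 := hf.1
  have e : ∀ r ∈ (Finset.univ : Finset (Tor L)).erase 0,
      f r ^ 4 = 1 - 4 * sfun L Δ f r + 6 * sfun L Δ f r ^ 2 - 4 * sfun L Δ f r ^ 3 + sfun L Δ f r ^ 4 := by
    intro r hr
    unfold sfun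
    rw [if_neg (Finset.ne_of_mem_erase hr)]
    ring
  have h04 : f 0 ^ 4 = 0 := by rw [h0]; norm_num
  unfold Q0
  rw [← Finset.sum_erase (Finset.univ : Finset (Tor L)) (f := fun r => f r ^ 4) h04, Finset.sum_congr rfl e]
  simp only [Finset.sum_add_distrib, Finset.sum_sub_distrib, ← Finset.mul_sum, Finset.sum_const, nsmul_eq_mul,
    mul_one, hs]
  have hc : (((Finset.univ : Finset (Tor L)).erase 0).card : ℝ) = (L : ℝ) ^ 2 - 1 := by
    rw [Finset.card_erase_of_mem (Finset.mem_univ _)]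
    have h1 : 1 ≤ (Finset.univ : Finset (Tor L)).card := Finset.card_pos.mpr ⟨0, Finset.mem_univ _⟩
    push_cast [Nat.cast_sub h1]
    rw [card_tor]
  rw [hc]
  ring

end RowC

/-- ★ **`Q0Expansion L Δ` holds.** [folklore] -/
theorem q0Expansion_holds (Δ : ℝ) : Q0Expansion L Δ :=
  fun _ _ hf => RowC.q0_expansion L hf

end Summit.HubbardSuperconductivity.HubbardSuperconductivity.Theorems.AnisotropyChord.Transfer.Fibre3

end
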